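import Summits.Parity.GeneralizedHardyLittlewood.Theorems.TypeI2Dilated.Negative.LogPowerBias

/-!
# `TypeI2Dilated` (stmt-Parity-14272): one-class ghosts (negative knowledge, refuter)

Support file for the crux `Summit.Parity.GeneralizedHardyLittlewood.Theses.LiouvilleShiftedTables.TypeI2Dilated`
(X2 of route LiouvilleShiftedTables), continuing `Negative/LogPowerBias.lean`.

* `BiasedClass f` — a persistent bias on ONE residue class of ONE modulus; `BiasedClass.logPowerBias`
  (it is the case `B = 1` of `LogPowerBias`), hence `not_typeI2DilatedFor_of_biasedClass`.
* Instances: `not_typeI2DilatedFor_one` (the crux is not a consequence of `|λ| ≤ 1`),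
  `not_typeI2DilatedFor_chi4` (`χ₄`: completely multiplicative, bounded, mean zero — so a proof must
  separate `λ` from characters of every conductor `≤ x^ρ`), `not_typeI2DilatedFor_liouville_corrupted`
  (`λ` changed on a single class of a single modulus already fails).
* `not_biasedClass_liouville` — none of this touches `λ` (Siegel–Walfisz, proved in tree).

Extracted from the disprover's work file `Disproof.lean` (evidence on stmt-Parity-14272).
-/

namespace Summit.Parity.GeneralizedHardyLittlewood.Cruxes.TypeI2Dilated.Negative

open Finset Real

/-- **One-class bias.** `f(· + 1)` has a persistent bias on a single residue class of a single
modulus: for some `q₁ ≥ 1`, `a`, `η > 0` and all large `N`,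
`η N ≤ |∑_{n ≤ N, n ≡ a (q₁)} f(n + 1)|`. -/
def BiasedClass (f : ℕ → ℝ) : Prop :=
  ∃ q₁ : ℕ, 1 ≤ q₁ ∧ ∃ a : ℕ, ∃ η : ℝ, 0 < η ∧ ∃ N₀ : ℕ, ∀ N : ℕ, N₀ ≤ N →
    η * N ≤ |∑ n ∈ (Finset.Icc 1 N).filter (fun n : ℕ => n ≡ a [MOD q₁]), f (n + 1)|

/-- A one-class bias at a FIXED modulus is the special case `B = 1`. -/
theorem BiasedClass.logPowerBias {f : ℕ → ℝ} (hf : BiasedClass f) : LogPowerBias f := by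
  obtain ⟨q₁, hq₁, a, η, hη, N₀, hbias⟩ := hf
  refine ⟨1, one_pos, η, hη, fun N₁ => ?_⟩
  obtain ⟨N, hN⟩ := exists_nat_ge (max (max (N₀ : ℝ) N₁) (Real.exp q₁))
  have hN₀ : (N₀ : ℝ) ≤ N := ((le_max_left _ _).trans (le_max_left _ _)).trans hN
  have hN₁ : (N₁ : ℝ) ≤ N := ((le_max_right _ _).trans (le_max_left _ _)).trans hN
  have heq : Real.exp q₁ ≤ N := (le_max_right _ _).trans hN
  have hq₁' : (0 : ℝ) < q₁ := by exact_mod_cast hq₁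
  refine ⟨N, by exact_mod_cast hN₁, q₁, hq₁, ?_, a, ?_⟩
  · rw [Real.rpow_one]
    calc (q₁ : ℝ) = Real.log (Real.exp q₁) := (Real.log_exp _).symm
      _ ≤ Real.log N := Real.log_le_log (Real.exp_pos _) heq
  · refine le_trans ?_ (hbias N (by exact_mod_cast hN₀))
    rw [div_le_iff₀ hq₁']
    have h0 : (0 : ℝ) ≤ η * N := by positivity
    have hq1 : (1 : ℝ) ≤ q₁ := by exact_mod_cast hq₁
    calc η * N = η * N * 1 := by ring
      _ ≤ η * N * q₁ := mul_le_mul_of_nonneg_left hq1 h0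

/-- **The ghost family.** A one-class bias at ANY fixed modulus `q₁` refutes the crux shape
(dilation `q = q₁`, class `w = a`, `c = 1`, `R = S = 1`, `y = x`: the single `(q₁, r = 1)` term is
`≥ η x > C x / log x`); formally the case `B = 1` of `not_typeI2DilatedFor_of_logPowerBias`. -/
theorem not_typeI2DilatedFor_of_biasedClass {f : ℕ → ℝ} (hf : BiasedClass f) :
    ¬ TypeI2DilatedFor f :=
  not_typeI2DilatedFor_of_logPowerBias hf.logPowerBias

/-! ### Instances of the ghost family -/

/-- Counting a residue class in `[1, N]`: at least `N/q - 1` elements. [folklore] -/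
theorem card_filter_modEq_ge (N q a : ℕ) (hq : 0 < q) :
    (N : ℝ) / q - 1 ≤ (((Finset.Icc 1 N).filter (fun n : ℕ => n ≡ a [MOD q])).card : ℝ) := by
  have hIcc : Finset.Icc 1 N = Finset.Ioc 0 N := rfl
  have h := Nat.Ioc_filter_modEq_card 0 N hq a
  rw [← hIcc, Nat.cast_zero] at h
  have h1 : (⌊((N : ℚ) - a) / q⌋ - ⌊((0 : ℚ) - a) / q⌋ : ℤ) ≤
      (((Finset.Icc 1 N).filter (fun n : ℕ => n ≡ a [MOD q])).card : ℤ) := by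
    have := le_max_left (⌊((N : ℚ) - a) / q⌋ - ⌊((0 : ℚ) - a) / q⌋) 0
    rw [← h] at this
    exact_mod_cast this
  have h2 : ((N : ℚ) - a) / q - 1 < ⌊((N : ℚ) - a) / q⌋ := Int.sub_one_lt_floor _
  have h3 : (⌊((0 : ℚ) - a) / q⌋ : ℚ) ≤ ((0 : ℚ) - a) / q := Int.floor_le _
  have h4 : (N : ℚ) / q - 1 ≤ (((Finset.Icc 1 N).filter (fun n : ℕ => n ≡ a [MOD q])).card : ℚ) := by
    have h1' : ((⌊((N : ℚ) - a) / q⌋ - ⌊((0 : ℚ) - a) / q⌋ : ℤ) : ℚ) ≤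
        (((Finset.Icc 1 N).filter (fun n : ℕ => n ≡ a [MOD q])).card : ℚ) := by exact_mod_cast h1
    push_cast at h1'
    have hq' : (0 : ℚ) < q := by exact_mod_cast hq
    have : (N : ℚ) / q - 1 = ((N : ℚ) - a) / q - 1 - ((0 : ℚ) - a) / q := by
      field_simp; ring
    linarith
  have h5 := (Rat.cast_le (K := ℝ)).2 h4
  push_cast at h5
  exact h5

/-- Constant and non-zero on ONE residue class of ONE modulus ⇒ one-class bias
(with `η = |v|/(2 q₁)`). [folklore] -/
theorem biasedClass_of_const_on_class {f : ℕ → ℝ} {q₁ a₀ : ℕ} (hq₁ : 1 ≤ q₁) {v : ℝ} (hv : v ≠ 0)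
    (hf : ∀ n : ℕ, 1 ≤ n → n ≡ a₀ [MOD q₁] → f n = v) : BiasedClass f := by
  refine ⟨q₁, hq₁, a₀ + (q₁ - 1), |v| / (2 * q₁), by positivity, 4 * q₁, fun N hN => ?_⟩
  set T := (Finset.Icc 1 N).filter (fun n : ℕ => n ≡ a₀ + (q₁ - 1) [MOD q₁]) with hT
  have hclass : ∀ n ∈ T, f (n + 1) = v := by
    intro n hn
    rw [hT, Finset.mem_filter] at hn
    refine hf (n + 1) (by omega) ?_
    have h1 : n + 1 ≡ a₀ + (q₁ - 1) + 1 [MOD q₁] := Nat.ModEq.add_right 1 hn.2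
    have h2 : a₀ + (q₁ - 1) + 1 = a₀ + q₁ := by omega
    rw [h2] at h1
    exact h1.trans Nat.add_modEq_right
  have hsum : ∑ n ∈ T, f (n + 1) = (T.card : ℝ) * v := by
    rw [Finset.sum_congr rfl hclass, Finset.sum_const, nsmul_eq_mul]
  have hcard : (N : ℝ) / q₁ - 1 ≤ (T.card : ℝ) := card_filter_modEq_ge N q₁ _ hq₁
  have hq₁' : (0 : ℝ) < q₁ := by exact_mod_cast hq₁
  have hN' : (4 : ℝ) * q₁ ≤ N := by exact_mod_cast hN
  rw [hsum, abs_mul, Nat.abs_cast]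
  have hcard2 : (N : ℝ) / (2 * q₁) ≤ (T.card : ℝ) := by
    have hA : (N : ℝ) / (2 * q₁) = (N : ℝ) / q₁ - (N : ℝ) / (2 * q₁) := by field_simp; ring
    have hB : (1 : ℝ) ≤ (N : ℝ) / (2 * q₁) := by rw [le_div_iff₀ (by positivity)]; linarith
    linarith
  calc |v| / (2 * q₁) * N = (N : ℝ) / (2 * q₁) * |v| := by ring
    _ ≤ (T.card : ℝ) * |v| := mul_le_mul_of_nonneg_right hcard2 (abs_nonneg v)

/-- **Ghost 1: the constant function.** The crux shape is not a consequence of `|λ| ≤ 1`. -/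
theorem not_typeI2DilatedFor_one : ¬ TypeI2DilatedFor (fun _ => (1 : ℝ)) :=
  not_typeI2DilatedFor_of_biasedClass
    (biasedClass_of_const_on_class (q₁ := 1) (a₀ := 0) le_rfl one_ne_zero (fun _ _ _ => rfl))

/-- The non-principal character mod 4, integer-valued. -/
def chi4Z (n : ℕ) : ℤ := if n % 4 = 1 then 1 else if n % 4 = 3 then -1 else 0

/-- The non-principal character mod 4 as a real-valued function. -/
def chi4 (n : ℕ) : ℝ := chi4Z n

/-- `χ₄ = 1` on the class `1 mod 4`. -/
theorem chi4_of_mod_one {n : ℕ} (h : n ≡ 1 [MOD 4]) : chi4 n = 1 := by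
  have h' : n % 4 = 1 := h
  unfold chi4 chi4Z; rw [if_pos h']; simp

/-- `χ₄` is completely multiplicative, bounded by `1` and has period `4` with mean zero — every
property of `λ` that the crux's FORM can see, except equidistribution in classes. -/
theorem chi4Z_mul (m n : ℕ) : chi4Z (m * n) = chi4Z m * chi4Z n := by
  have key : ∀ a b : Fin 4, chi4Z (a.val * b.val % 4) = chi4Z a.val * chi4Z b.val := by decide
  have h1 : chi4Z (m * n) = chi4Z (m % 4 * (n % 4) % 4) := by
    unfold chi4Z; rw [Nat.mod_mod, ← Nat.mul_mod]
  have h2 : chi4Z m = chi4Z (m % 4) := by unfold chi4Z; rw [Nat.mod_mod]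
  have h3 : chi4Z n = chi4Z (n % 4) := by unfold chi4Z; rw [Nat.mod_mod]
  rw [h1, h2, h3]
  exact key ⟨m % 4, Nat.mod_lt _ (by norm_num)⟩ ⟨n % 4, Nat.mod_lt _ (by norm_num)⟩

/-- `χ₄` is completely multiplicative (real-valued form). -/
theorem chi4_mul (m n : ℕ) : chi4 (m * n) = chi4 m * chi4 n := by
  unfold chi4; rw [chi4Z_mul]; push_cast; ring

/-- `|χ₄| ≤ 1`. -/
theorem abs_chi4_le (n : ℕ) : |chi4 n| ≤ 1 := by
  unfold chi4 chi4Z; split_ifs <;> simp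

/-- `χ₄` has period `4` and mean zero over each period. -/
theorem chi4_period_sum (k : ℕ) :
    chi4 (4 * k + 1) + chi4 (4 * k + 2) + chi4 (4 * k + 3) + chi4 (4 * k + 4) = 0 := by
  have h1 : (4 * k + 1) % 4 = 1 := by omega
  have h2 : (4 * k + 2) % 4 = 2 := by omega
  have h3 : (4 * k + 3) % 4 = 3 := by omega
  have h4 : (4 * k + 4) % 4 = 0 := by omega
  simp [chi4, chi4Z, h1, h2, h3, h4]

/-- **Ghost 2: a character.** `χ₄` fails the crux shape (it is constant `= 1` on `1 mod 4`):
any proof for `λ` must separate `λ` from characters of EVERY conductor `≤ x^ρ` with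
`(log x)^{-A}` savings — Siegel–Walfisz for `λ` in the small-conductor range, hence ineffective `C`. -/
theorem not_typeI2DilatedFor_chi4 : ¬ TypeI2DilatedFor chi4 :=
  not_typeI2DilatedFor_of_biasedClass
    (biasedClass_of_const_on_class (q₁ := 4) (a₀ := 1) (by norm_num) one_ne_zero
      (fun _ _ h => chi4_of_mod_one h))

/-- **Ghost 3: Liouville corrupted on a single class.** Changing `λ` to `+1` on the one class
`1 mod q₁` (any `q₁ ≥ 1`; density `1/q₁`, and only half of those values actually change) already
breaks the crux shape: the statement inspects every class of every modulus `≤ x^ρ` individually. -/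
theorem not_typeI2DilatedFor_liouville_corrupted {q₁ : ℕ} (hq₁ : 1 ≤ q₁) :
    ¬ TypeI2DilatedFor (fun n => if n % q₁ = 1 % q₁ then (1 : ℝ) else (ArithmeticFunction.liouville n : ℝ)) :=
  not_typeI2DilatedFor_of_biasedClass
    (biasedClass_of_const_on_class (q₁ := q₁) (a₀ := 1) hq₁ one_ne_zero
      (fun n _ h => by simp only [Nat.ModEq] at h; rw [if_pos h]))

/-! ### The ghost family is exhausted for `λ` -/

/-- **`λ` has no one-class bias** (so `not_typeI2DilatedFor_of_biasedClass` can never be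
instantiated at `f = λ`): the case `B = 1` of `not_logPowerBias_liouville`, i.e. Siegel–Walfisz for
`λ` in progressions, PROVED in the tree
(`Literature.NumberTheory.LFunctions.SiegelWalfiszMoebius_holds.liouville_progression`). This is
the formal content of "the crux resists every cheap (one dilation, one class) attack". -/
theorem not_biasedClass_liouville :
    ¬ BiasedClass (fun n => (ArithmeticFunction.liouville n : ℝ)) :=
  fun h => not_logPowerBias_liouville h.logPowerBias

end Summit.Parity.GeneralizedHardyLittlewood.Cruxes.TypeI2Dilated.Negative
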